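import Summits.QuantumFields.YangMills.Theorems.FluctuationComparisonRegPrIntLS2BetaRelativeKeyLemmaTorus
import Summits.QuantumFields.YangMills.Theorems.FluctuationComparisonRegPrIntLS2BetaRelativeHstepHjBkg
import HarnessLib

/-!
# S2β · letter (D♮)∕(D-stage) REL-TEL, the (C)-half — ★★★ THE RELATIVE KEY LEMMA TOWER ON A `d = 3` TORUS, BACKGROUND-PRICED, END TO END
# (✓∕⧗`relHstep_hj_bkg` at every level `t < m` of a pair of `exp[mean log]` averaging towers on `SU(N)` ∘ ✓∕⧗`relKeyLemma_torus_of_step`):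
# `‖δ_t‖₂ ≤ exp(Σ_{i<m}(26((d+2)L)²θ_i + ε_i∕√L))·((√L)^t·‖δ_0‖₂ + Σ_{s<t}(√L)^{t−1−s}·η_s)`, `ε_i = κ_i·cε_i·√N_□`, `η_s = (κ_s·cβ_s + 5L³θ₀,s)·√N_b·‖dev_s‖₂`,
# `κ_t = 1.5·10⁶·((d+2)L)²θ₀,t + 1.1·10⁷·β♯_t` — the FIELD's history thresholds `θ_t` in the exponent's main part ONLY; every source priced by BKG `θ₀,t` + supRel `β♯_t`

Cell `ym3-torus` (rung R3 = continuum `SU(2)` Yang–Mills on the three-torus — NOT d = 4, NOT infinite volume, NOT a mass gap, NOT Clay).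
Width seat «width 10» `ym3-torus-px10` (gen 23), FREE px helper on crux `stmt-QuantumFields-20520`, count-neutral, DEFINITION-FREE; own-risk brick of the px10 lane
«(C)-half of letter (D♮)» (UV3-NODE §82) — its END-TO-END composition on a generic `d = 3` torus (`P.d = 3`, depth `m ≤ P.m + P.K`, ANY `SU(N)`, ANY pair of level-`0`
fields): INPUTS per level `t < m` = {history threshold `θ_t` of the FIELD tower (`PlaqSmall θ_t (M^tU)`, `((d+2)L)²θ_t ≤ 1∕800`, guard `((d+2)L)²θ_t∕4 < δ_N`), BKG size
`θ₀,t ≤ θ_t` of the BACKGROUND tower (`PlaqSmall θ₀,t (M^tU₀)`), the LOCAL RELATIVE DATA `β_t : Plaq_{t+1} → [0, β♯_t]` (`β♯_t ≤ 1∕6400`) bounding the relative member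
loops ∕ axial ∕ staircase transports of `(M^tU, M^tU₀)` and SUPPLIED by `β_t Q ≤ cβ_t·Σ_{near Q} dev_t + cε_t·Σ_{near Q} δ_t`}; OUTPUT = the displayed `ℓ²` tower bound on
the relative plaquette functions `δ_t p := dist1((M^tU₀)(∂p)⁻¹(M^tU)(∂p))` with sources `η_s ∝ ‖dev_s‖₂` (relative bond deviations of level `s`) carried with the SHARP weight
`(√L)^{t−1−s}` — the `C·(√L)^j·S + Σ_{u≤j} W j u·B_u` row of px12 g24's (H♭♭) (✓∕⧗`dockRel_of_towers_feedback`) on the (C)-side, `W j u` read off.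
* ★★★ `relKeyLemma_torus_bkg`.

HONEST SCOPE.  A composition of landed∕signed letters; nothing of Bałaban's renormalisation analysis asserted or proved; on the T³ RECORD the inputs are OWED: the BKG-tower
letter (`θ₀,t` for the averaged ARGMIN — [Balaban1985Variational] Thm 1 (9)–(10) + [Balaban1985Averaging]; px5 g22 ✓p822405 = level 0), the sup-profile `β♯_t`, the
β-suppliers `cβ_t, cε_t` (px21 g23 ✓p823652 ∕ ✓p824227), the history thresholds (`histGood`); (H♭♭)'s other rows, (D-stage), GAP♯∘ (`stub_uniformFibreGapOrbit`), S2β, crux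
20520 and `YM3TorusSU2` are NOT proved; no registered stub is closed; the Yang–Mills mass gap is NOT proved.  Sorry-free, axioms standard.
References: T. Bałaban, CMP **98** (1985) 17–51 [Balaban1985Averaging] ((19) p.21); CMP **99** (1985) 75–102 [Balaban1985RegularSpaces] (Lemma 1 p.79, Thm 2 p.83);
CMP **109** (1987) 249–301 [Balaban1987RG1] ((0.4)–(0.8) p.253).
-/

set_option autoImplicit false

noncomputable section

open Finset
open scoped BigOperators

namespace Summit.QuantumFields.YangMills.Theorems.FluctuationComparisonRegPrIntLS2BetaRelativeKeyLemmaTorusBkg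

open Literature.MathematicalPhysics.QuantumFieldTheory.Balaban1983to89
open T4Continuum BlockAveraging AveragingRT
open Literature.MathematicalPhysics.QuantumFieldTheory.Balaban1983to89.ExpMeanLog (expMeanLogSU deltaSU)
open Literature.MathematicalPhysics.QuantumFieldTheory.Balaban1983to89.T4TiltOscillation (bdev)
open B10Eq47AxialChi (shiftN)
open Summit.QuantumFields.YangMills.Theorems.FluctuationComparisonRegPrIntLS2BetaRelativeKeyLemmaTorus (relKeyLemma_torus_of_step)
open Summit.QuantumFields.YangMills.Theorems.FluctuationComparisonRegPrIntLS2BetaRelativeHstepHjBkg (relHstep_hj_bkg)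

variable {P : Params} {n : Type*} [Fintype n] [DecidableEq n] [Nonempty n]

/-- ★★★ **THE RELATIVE KEY LEMMA TOWER ON A `d = 3` TORUS, BACKGROUND-PRICED, END TO END** (`M^t := Averaging.iter (blockAvg expMeanLogSU) t`; see the module
docstring for the inputs).  For every `t ≤ m`:
`√Σ_p δ_t(p)² ≤ exp(Σ_{i<m}(26·((d+2)L)²θ_i + κ_i·cε_i·√((3^dL^dd²)(3^dd²))∕√L))·((√L)^t·√Σ_p δ_0(p)² + Σ_{s<t}(√L)^{t−1−s}·(κ_s·cβ_s + 5L³θ₀,s)·√((3^dL^dd)(3^dd²))·√Σ_c dist1(dev_s c)²)`,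
`κ_t := 1500000·((d+2)L)²θ₀,t + 11000000·β♯_t`. [cite: Balaban1985Averaging, (19) p.21; Balaban1985RegularSpaces, Lemma 1 p.79] -/
theorem relKeyLemma_torus_bkg (hd : P.d = 3) {m : ℕ} (hm : m ≤ P.m + P.K) (U U₀ : GaugeField P 0 (Matrix.specialUnitaryGroup n ℂ))
    (θ θ₀ βs cβ cε : ℕ → ℝ) (hθ₀0 : ∀ t, t < m → 0 ≤ θ₀ t) (hθ₀θ : ∀ t, t < m → θ₀ t ≤ θ t)
    (hθ : ∀ t, t < m → (((P.d + 2) * P.L : ℕ) : ℝ) ^ 2 * θ t ≤ 1 / 800) (hδ : ∀ t, t < m → (((P.d + 2) * P.L : ℕ) : ℝ) ^ 2 / 4 * θ t < deltaSU n)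
    (hU : ∀ t, t < m → PlaqSmall (θ t) (Averaging.iter (fun k => blockAvg (P := P) (j := k) (expMeanLogSU (n := n))) t U))
    (hU₀ : ∀ t, t < m → PlaqSmall (θ₀ t) (Averaging.iter (fun k => blockAvg (P := P) (j := k) (expMeanLogSU (n := n))) t U₀))
    (β : (t : ℕ) → Plaq P (t + 1) → ℝ) (hβ0 : ∀ t, t < m → ∀ Q, 0 ≤ β t Q) (hβs0 : ∀ t, t < m → 0 ≤ βs t)
    (hβsup : ∀ t, t < m → ∀ Q, β t Q ≤ βs t) (hβs : ∀ t, t < m → βs t ≤ 1 / 6400) (hcβ : ∀ t, t < m → 0 ≤ cβ t) (hcε : ∀ t, t < m → 0 ≤ cε t)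
    (hW : ∀ t, t < m → ∀ (Q : Plaq P (t + 1)) (c : PBond P (t + 1)),
      (c = ⟨Q.src, Q.μ⟩ ∨ c = ⟨Q.src.shift Q.μ, Q.ν⟩ ∨ c = ⟨Q.src.shift Q.ν, Q.μ⟩ ∨ c = ⟨Q.src, Q.ν⟩) →
      ∀ i, dist1 ((loopHol (Averaging.iter (fun k => blockAvg (P := P) (j := k) (expMeanLogSU (n := n))) t U₀) c i)⁻¹ *
        loopHol (Averaging.iter (fun k => blockAvg (P := P) (j := k) (expMeanLogSU (n := n))) t U) c i) ≤ β t Q)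
    (hA : ∀ t, t < m → ∀ (Q : Plaq P (t + 1)) (c : PBond P (t + 1)),
      (c = ⟨Q.src, Q.μ⟩ ∨ c = ⟨Q.src.shift Q.μ, Q.ν⟩ ∨ c = ⟨Q.src.shift Q.ν, Q.μ⟩ ∨ c = ⟨Q.src, Q.ν⟩) →
      dist1 ((axialAvg (Averaging.iter (fun k => blockAvg (P := P) (j := k) (expMeanLogSU (n := n))) t U₀) c)⁻¹ *
        axialAvg (Averaging.iter (fun k => blockAvg (P := P) (j := k) (expMeanLogSU (n := n))) t U) c) ≤ β t Q)
    (hS : ∀ t, t < m → ∀ (Q : Plaq P (t + 1)) (i : Idx P),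
      dist1 ((holAt (Averaging.iter (fun k => blockAvg (P := P) (j := k) (expMeanLogSU (n := n))) t U₀) (walk (emb Q.src) (stairWord i.2.1 (off i.1))))⁻¹ *
        holAt (Averaging.iter (fun k => blockAvg (P := P) (j := k) (expMeanLogSU (n := n))) t U) (walk (emb Q.src) (stairWord i.2.1 (off i.1)))) ≤ β t Q)
    (hβ : ∀ t, t < m → ∀ Q : Plaq P (t + 1), β t Q ≤
      cβ t * ∑ c ∈ Finset.univ.filter (fun c : PBond P t => ∀ κ, blockOf c.src κ = Q.src κ ∨ blockOf c.src κ = Q.src κ + 1 ∨ blockOf c.src κ = Q.src κ - 1),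
        dist1 (bdev (Averaging.iter (fun k => blockAvg (P := P) (j := k) (expMeanLogSU (n := n))) t U)
          (Averaging.iter (fun k => blockAvg (P := P) (j := k) (expMeanLogSU (n := n))) t U₀) c) +
      cε t * ∑ q ∈ Finset.univ.filter (fun q : Plaq P t => ∀ κ, blockOf q.src κ = Q.src κ ∨ blockOf q.src κ = Q.src κ + 1 ∨ blockOf q.src κ = Q.src κ - 1),
        dist1 ((GaugeField.plaqHol (Averaging.iter (fun k => blockAvg (P := P) (j := k) (expMeanLogSU (n := n))) t U₀) q)⁻¹ *
          GaugeField.plaqHol (Averaging.iter (fun k => blockAvg (P := P) (j := k) (expMeanLogSU (n := n))) t U) q)) :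
    ∀ t, t ≤ m →
      √(∑ p : Plaq P t, dist1 ((GaugeField.plaqHol (Averaging.iter (fun k => blockAvg (P := P) (j := k) (expMeanLogSU (n := n))) t U₀) p)⁻¹ *
          GaugeField.plaqHol (Averaging.iter (fun k => blockAvg (P := P) (j := k) (expMeanLogSU (n := n))) t U) p) ^ 2) ≤
        Real.exp (∑ i ∈ range m, (26 * ((((P.d + 2) * P.L : ℕ) : ℝ) ^ 2 * θ i) +
            (1500000 * ((((P.d + 2) * P.L : ℕ) : ℝ) ^ 2 * θ₀ i) + 11000000 * βs i) * cε i *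
              √(((3 ^ P.d * P.L ^ P.d * P.d ^ 2 : ℕ) : ℝ) * ((3 ^ P.d * P.d ^ 2 : ℕ) : ℝ)) / Real.sqrt (P.L : ℝ))) *
          (Real.sqrt (P.L : ℝ) ^ t * √(∑ p : Plaq P 0, dist1 ((GaugeField.plaqHol U₀ p)⁻¹ * GaugeField.plaqHol U p) ^ 2) +
            ∑ s ∈ range t, Real.sqrt (P.L : ℝ) ^ (t - 1 - s) *
              (((1500000 * ((((P.d + 2) * P.L : ℕ) : ℝ) ^ 2 * θ₀ s) + 11000000 * βs s) * cβ s + 5 * (P.L : ℝ) ^ 3 * θ₀ s) *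
                √(((3 ^ P.d * P.L ^ P.d * P.d : ℕ) : ℝ) * ((3 ^ P.d * P.d ^ 2 : ℕ) : ℝ)) *
                √(∑ c : PBond P s, dist1 (bdev (Averaging.iter (fun k => blockAvg (P := P) (j := k) (expMeanLogSU (n := n))) s U)
                  (Averaging.iter (fun k => blockAvg (P := P) (j := k) (expMeanLogSU (n := n))) s U₀) c) ^ 2))) := by
  have hlev : ∀ t, t < m → t + 1 ≤ P.m + P.K := fun t ht => by omega
  -- the per-level `hstep`∕`hj` pair (✓`relHstep_hj_bkg` at level `t` on the pair `(M^tU, M^tU₀)`)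
  have H := fun t (ht : t < m) => relHstep_hj_bkg (hlev t ht)
    (Averaging.iter (fun k => blockAvg (P := P) (j := k) (expMeanLogSU (n := n))) t U)
    (Averaging.iter (fun k => blockAvg (P := P) (j := k) (expMeanLogSU (n := n))) t U₀)
    (hθ₀0 t ht) (hθ₀θ t ht) (hθ t ht) (hδ t ht) (hU t ht) (hU₀ t ht) (β t) (hβ0 t ht) (hβs0 t ht) (hβsup t ht) (hβs t ht) (hcβ t ht) (hcε t ht)
    (hW t ht) (hA t ht) (hS t ht) (hβ t ht)
  have hθ0 : ∀ t, t < m → 0 ≤ (((P.d + 2) * P.L : ℕ) : ℝ) ^ 2 * θ t := fun t ht =>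
    mul_nonneg (sq_nonneg _) ((hθ₀0 t ht).trans (hθ₀θ t ht))
  have hκ0 : ∀ t, t < m → 0 ≤ 1500000 * ((((P.d + 2) * P.L : ℕ) : ℝ) ^ 2 * θ₀ t) + 11000000 * βs t := fun t ht => by
    have := hθ₀0 t ht; have := hβs0 t ht; positivity
  refine relKeyLemma_torus_of_step hd (expMeanLogSU (n := n)) hm U U₀ (fun t => (((P.d + 2) * P.L : ℕ) : ℝ) ^ 2 * θ t)
    (fun t => (1500000 * ((((P.d + 2) * P.L : ℕ) : ℝ) ^ 2 * θ₀ t) + 11000000 * βs t) * cε t *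
      √(((3 ^ P.d * P.L ^ P.d * P.d ^ 2 : ℕ) : ℝ) * ((3 ^ P.d * P.d ^ 2 : ℕ) : ℝ)))
    (fun s => ((1500000 * ((((P.d + 2) * P.L : ℕ) : ℝ) ^ 2 * θ₀ s) + 11000000 * βs s) * cβ s + 5 * (P.L : ℝ) ^ 3 * θ₀ s) *
      √(((3 ^ P.d * P.L ^ P.d * P.d : ℕ) : ℝ) * ((3 ^ P.d * P.d ^ 2 : ℕ) : ℝ)) *
      √(∑ c : PBond P s, dist1 (bdev (Averaging.iter (fun k => blockAvg (P := P) (j := k) (expMeanLogSU (n := n))) s U)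
        (Averaging.iter (fun k => blockAvg (P := P) (j := k) (expMeanLogSU (n := n))) s U₀) c) ^ 2))
    hθ0 (fun t ht => by have := hκ0 t ht; have := hcε t ht; positivity)
    (fun t ht => by have := hκ0 t ht; have := hcβ t ht; have := hθ₀0 t ht; positivity) (by norm_num : (0 : ℝ) ≤ 26)
    (fun t Q => (1500000 * ((((P.d + 2) * P.L : ℕ) : ℝ) ^ 2 * θ₀ t) + 11000000 * βs t) * β t Q +
      5 * (P.L : ℝ) ^ 3 * θ₀ t * ∑ c ∈ Finset.univ.filter (fun c : PBond P t => ∀ κ, blockOf c.src κ = Q.src κ ∨ blockOf c.src κ = Q.src κ + 1),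
        dist1 (bdev (Averaging.iter (fun k => blockAvg (P := P) (j := k) (expMeanLogSU (n := n))) t U)
          (Averaging.iter (fun k => blockAvg (P := P) (j := k) (expMeanLogSU (n := n))) t U₀) c))
    (fun t ht Q => (H t ht).1 Q) (fun t ht => (H t ht).2)

end Summit.QuantumFields.YangMills.Theorems.FluctuationComparisonRegPrIntLS2BetaRelativeKeyLemmaTorusBkg

end
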